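import Mathlib
import Summits.Ventures.PercRepro2.TriDisagreementPinned

/-!
# Typed-base reductions I: splitting one typed edge off (blind cell PercRepro2, night-3 g2,
2026-08-24; the typed-base reduction lemma of `proofs/LEAD-TYPED-REDUCTION.md` §1 on the count)

The typed three-copy count `typedCount F z τ K` of `TriDisagreementPinned.lean` (the typed base
`N_τ` of row 2′TRI when `K = K₃`) is a finite sum over the `3`-colourings of the typed edge set
`F`; this file is its bookkeeping, for an arbitrary kernel `K`:

* **`typedCount_split`** — one typed edge `e ∈ F` is split off: the count over `F` is the sum,
  over the `(a, b, c) ∈ Bool³` with `a + b + c = τ e`, of the counts over `F ∖ {e}` (pinned closed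
  at `e`) of the kernel with the three copies updated at `e` to `a, b, c`;
* `typedCount_congr_τ` / `typedCount_congr_z` / `typedCount_congr_K` / `typedCount_add` /
  `typedCount_ite` — the count sees `τ` only on `F`, `z` only off `F`, and is linear in the kernel;
* `typedCount_insert_pinned`, `typedCount_type_zero`, `typedCount_type_three`,
  `typedCount_split_zero`, `typedCount_split_three` — a pinned edge is the same as a typed edge of
  the pinned type `0` (closed) or `3` (open), and conversely.
-/

namespace Summit.Ventures.PercRepro2

namespace CovForm

namespace TypedRed

section Split

variable {E : Type*} [Fintype E] [DecidableEq E] {R : Type*} [CommRing R]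

omit [Fintype E] in
/-- Updating at `e` by the current value is the identity. -/
lemma update_self_of_eq (x : Config E) (e : E) (a : Bool) (h : x e = a) :
    Function.update x e a = x := by
  subst h; exact Function.update_eq_self e x

/-- Splitting a sum over configurations by the state of one edge: every configuration is
`x[e ↦ a]` for a unique `x` with `x e = false` and a unique `a`. -/
lemma sum_split_edge (e : E) (g : Config E → R) :
    (∑ x : Config E, g x) =
      ∑ a : Bool, ∑ x : Config E, if x e = false then g (Function.update x e a) else 0 := by
  have hinv : Function.Involutive (fun x : Config E => Function.update x e (!x e)) := by
    intro x
    funext e'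
    by_cases he : e' = e
    · subst he; simp
    · simp [Function.update_of_ne he]
  rw [Fintype.sum_bool]
  have hsplit : (∑ x : Config E, g x) =
      (∑ x : Config E, if x e = true then g x else 0) +
        ∑ x : Config E, if x e = false then g x else 0 := by
    rw [← Finset.sum_add_distrib]
    refine Finset.sum_congr rfl fun x _ => ?_
    cases x e <;> simp
  rw [hsplit]
  congr 1
  · rw [← Equiv.sum_comp (Function.Involutive.toPerm _ hinv)
      (fun x => if x e = true then g x else 0)]
    refine Finset.sum_congr rfl fun x _ => ?_
    simp only [Function.Involutive.coe_toPerm]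
    cases x e <;> simp
  · refine Finset.sum_congr rfl fun x _ => ?_
    by_cases hx : x e = false
    · simp only [hx, if_true, update_self_of_eq x e false hx]
    · simp [hx]

/-- A constant condition is pulled inside a sum. -/
lemma ite_sum {ι : Type*} (s : Finset ι) (A : Prop) [Decidable A] (f : ι → R) :
    (if A then (∑ i ∈ s, f i) else 0) = ∑ i ∈ s, if A then f i else 0 := by
  by_cases hA : A <;> simp [hA]

omit [Fintype E] in
/-- The condition of the typed count, after the three copies have been updated at `e ∈ F`
from configurations closed at `e`. -/
lemma cond_split (F : Finset E) (e : E) (he : e ∈ F) (z : Config E) (τ : E → ℕ)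
    (x y w : Config E) (hx : x e = false) (hy : y e = false) (hw : w e = false) (a b c : Bool) :
    ((∀ e', e' ∉ F → Function.update x e a e' = z e' ∧ Function.update y e b e' = z e' ∧
        Function.update w e c e' = z e') ∧
      (∀ e' ∈ F, openCount (Function.update x e a) (Function.update y e b)
        (Function.update w e c) e' = τ e')) ↔
    (a.toNat + b.toNat + c.toNat = τ e ∧
      ((∀ e', e' ∉ F.erase e → x e' = Function.update z e false e' ∧
          y e' = Function.update z e false e' ∧ w e' = Function.update z e false e') ∧
        (∀ e' ∈ F.erase e, openCount x y w e' = τ e'))) := by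
  constructor
  · rintro ⟨h1, h2⟩
    refine ⟨?_, ⟨fun e' he' => ?_, fun e' he' => ?_⟩⟩
    · have := h2 e he
      simpa [openCount] using this
    · rw [Finset.mem_erase, not_and_or, not_not] at he'
      rcases he' with rfl | he'
      · simp [hx, hy, hw]
      · have := h1 e' he'
        have hne : e' ≠ e := fun h => he' (h ▸ he)
        simpa [Function.update_of_ne hne] using this
    · rw [Finset.mem_erase] at he'
      have := h2 e' he'.2
      simpa [openCount, Function.update_of_ne he'.1] using this
  · rintro ⟨h0, h1, h2⟩
    refine ⟨fun e' he' => ?_, fun e' he' => ?_⟩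
    · have hne : e' ≠ e := fun h => he' (h ▸ he)
      have := h1 e' (by rw [Finset.mem_erase]; exact fun h => he' h.2)
      simpa [Function.update_of_ne hne] using this
    · by_cases hee : e' = e
      · subst hee
        simpa [openCount] using h0
      · have := h2 e' (Finset.mem_erase.2 ⟨hee, he'⟩)
        simpa [openCount, Function.update_of_ne hee] using this

/-- **Splitting one typed edge off**: the typed count over `F ∋ e` is the sum, over the
`(a, b, c) ∈ Bool³` with `a + b + c = τ e`, of the typed counts over `F ∖ {e}` (pinned closed at
`e`) of the kernel with the three copies updated at `e` to `a, b, c`. -/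
theorem typedCount_split (F : Finset E) (e : E) (he : e ∈ F) (z : Config E) (τ : E → ℕ)
    (K : Config E → Config E → Config E → R) :
    typedCount F z τ K =
      ∑ a : Bool, ∑ b : Bool, ∑ c : Bool,
        if a.toNat + b.toNat + c.toNat = τ e then
          typedCount (F.erase e) (Function.update z e false) τ
            (fun x y w => K (Function.update x e a) (Function.update y e b)
              (Function.update w e c))
        else 0 := by
  unfold typedCount
  -- the summand
  set S : Config E → Config E → Config E → R := fun x y w =>
    if (∀ e', e' ∉ F → x e' = z e' ∧ y e' = z e' ∧ w e' = z e') ∧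
        (∀ e' ∈ F, openCount x y w e' = τ e') then K x y w else 0 with hS
  set S' : Bool → Bool → Bool → Config E → Config E → Config E → R := fun a b c x y w =>
    if (∀ e', e' ∉ F.erase e → x e' = Function.update z e false e' ∧
          y e' = Function.update z e false e' ∧ w e' = Function.update z e false e') ∧
        (∀ e' ∈ F.erase e, openCount x y w e' = τ e') then
      K (Function.update x e a) (Function.update y e b) (Function.update w e c) else 0 with hS'
  show (∑ x, ∑ y, ∑ w, S x y w) = ∑ a, ∑ b, ∑ c, if a.toNat + b.toNat + c.toNat = τ e then
    (∑ x, ∑ y, ∑ w, S' a b c x y w) else 0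
  calc (∑ x, ∑ y, ∑ w, S x y w)
      = ∑ a : Bool, ∑ x, if x e = false then ∑ y, ∑ w, S (Function.update x e a) y w else 0 :=
        sum_split_edge e _
    _ = ∑ a : Bool, ∑ x, if x e = false then
          ∑ b : Bool, ∑ y, if y e = false then
            ∑ w, S (Function.update x e a) (Function.update y e b) w else 0 else 0 := by
        refine Finset.sum_congr rfl fun a _ => Finset.sum_congr rfl fun x _ => ?_
        by_cases hx : x e = false
        · simp only [hx, if_true]
          exact sum_split_edge e _
        · rw [if_neg hx, if_neg hx]
    _ = ∑ a : Bool, ∑ x, if x e = false then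
          ∑ b : Bool, ∑ y, if y e = false then
            ∑ c : Bool, ∑ w, if w e = false then
              S (Function.update x e a) (Function.update y e b) (Function.update w e c)
            else 0 else 0 else 0 := by
        refine Finset.sum_congr rfl fun a _ => Finset.sum_congr rfl fun x _ => ?_
        by_cases hx : x e = false
        · simp only [hx, if_true]
          refine Finset.sum_congr rfl fun b _ => Finset.sum_congr rfl fun y _ => ?_
          by_cases hy : y e = false
          · simp only [hy, if_true]
            exact sum_split_edge e _
          · rw [if_neg hy, if_neg hy]
        · rw [if_neg hx, if_neg hx]
    _ = ∑ a : Bool, ∑ b : Bool, ∑ c : Bool, ∑ x, ∑ y, ∑ w,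
          if x e = false then if y e = false then if w e = false then
            S (Function.update x e a) (Function.update y e b) (Function.update w e c)
          else 0 else 0 else 0 := by
        refine Finset.sum_congr rfl fun a _ => ?_
        -- pull `∑ b` and `∑ c` out
        simp only [ite_sum]
        rw [Finset.sum_comm]
        refine Finset.sum_congr rfl fun b _ => ?_
        symm
        rw [Finset.sum_comm]
        exact Finset.sum_congr rfl fun x _ => Finset.sum_comm
    _ = ∑ a, ∑ b, ∑ c, if a.toNat + b.toNat + c.toNat = τ e then
          (∑ x, ∑ y, ∑ w, S' a b c x y w) else 0 := by
        refine Finset.sum_congr rfl fun a _ => Finset.sum_congr rfl fun b _ =>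
          Finset.sum_congr rfl fun c _ => ?_
        simp only [ite_sum]
        refine Finset.sum_congr rfl fun x _ => Finset.sum_congr rfl fun y _ =>
          Finset.sum_congr rfl fun w _ => ?_
        by_cases hx : x e = false
        · by_cases hy : y e = false
          · by_cases hw : w e = false
            · simp only [hx, hy, hw, if_true, hS, hS']
              simp only [cond_split F e he z τ x y w hx hy hw a b c, ite_and]
            · rw [if_pos hx, if_pos hy, if_neg hw]
              simp only [hS']
              split_ifs with h0 h1
              · exact absurd (by simpa using (h1.1 e (by simp)).2.2) hw
              · rfl
              · rfl
          · rw [if_pos hx, if_neg hy]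
            simp only [hS']
            split_ifs with h0 h1
            · exact absurd (by simpa using (h1.1 e (by simp)).2.1) hy
            · rfl
            · rfl
        · rw [if_neg hx]
          simp only [hS']
          split_ifs with h0 h1
          · exact absurd (by simpa using (h1.1 e (by simp)).1) hx
          · rfl
          · rfl

end Split

/-! ## Bookkeeping lemmas for `typedCount` -/

section Book

variable {E : Type*} [Fintype E] [DecidableEq E] {R : Type*} [CommRing R]

/-- The typed count only sees `τ` on `F`. -/
lemma typedCount_congr_τ (F : Finset E) (z : Config E) {τ τ' : E → ℕ} (h : ∀ e ∈ F, τ e = τ' e)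
    (K : Config E → Config E → Config E → R) : typedCount F z τ K = typedCount F z τ' K := by
  unfold typedCount
  refine Finset.sum_congr rfl fun x _ => Finset.sum_congr rfl fun y _ =>
    Finset.sum_congr rfl fun w _ => ?_
  refine if_congr ?_ rfl rfl
  constructor
  · rintro ⟨h1, h2⟩; exact ⟨h1, fun e he => (h2 e he).trans (h e he)⟩
  · rintro ⟨h1, h2⟩; exact ⟨h1, fun e he => (h2 e he).trans (h e he).symm⟩

/-- The typed count only sees `z` off `F`. -/
lemma typedCount_congr_z (F : Finset E) {z z' : Config E} (h : ∀ e, e ∉ F → z e = z' e)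
    (τ : E → ℕ) (K : Config E → Config E → Config E → R) :
    typedCount F z τ K = typedCount F z' τ K := by
  unfold typedCount
  refine Finset.sum_congr rfl fun x _ => Finset.sum_congr rfl fun y _ =>
    Finset.sum_congr rfl fun w _ => ?_
  refine if_congr ?_ rfl rfl
  constructor
  · rintro ⟨h1, h2⟩
    refine ⟨fun e he => ?_, h2⟩
    obtain ⟨hx, hy, hw⟩ := h1 e he
    exact ⟨hx.trans (h e he), hy.trans (h e he), hw.trans (h e he)⟩
  · rintro ⟨h1, h2⟩
    refine ⟨fun e he => ?_, h2⟩
    obtain ⟨hx, hy, hw⟩ := h1 e he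
    exact ⟨hx.trans (h e he).symm, hy.trans (h e he).symm, hw.trans (h e he).symm⟩

/-- Pointwise equal kernels have equal typed counts. -/
lemma typedCount_congr_K (F : Finset E) (z : Config E) (τ : E → ℕ)
    {K K' : Config E → Config E → Config E → R} (h : ∀ x y w, K x y w = K' x y w) :
    typedCount F z τ K = typedCount F z τ K' := by
  unfold typedCount
  simp only [h]

/-- The typed count is additive in the kernel. -/
lemma typedCount_add (F : Finset E) (z : Config E) (τ : E → ℕ)
    (K K' : Config E → Config E → Config E → R) :
    typedCount F z τ (fun x y w => K x y w + K' x y w) = typedCount F z τ K + typedCount F z τ K' := by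
  unfold typedCount
  simp only [← Finset.sum_add_distrib]
  refine Finset.sum_congr rfl fun x _ => Finset.sum_congr rfl fun y _ =>
    Finset.sum_congr rfl fun w _ => ?_
  split_ifs <;> simp

/-- A constant condition on the kernel is pulled out of the typed count. -/
lemma typedCount_ite (F : Finset E) (z : Config E) (τ : E → ℕ) (P : Prop) [Decidable P]
    (K : Config E → Config E → Config E → R) :
    typedCount F z τ (fun x y w => if P then K x y w else 0) =
      if P then typedCount F z τ K else 0 := by
  by_cases hP : P
  · simp only [hP, if_true]
  · simp only [hP, if_false]
    unfold typedCount
    simp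

/-- Updating the copies at a pinned edge `f ∉ F` to its pinned value changes nothing. -/
lemma typedCount_update_pinned (F : Finset E) (f : E) (hf : f ∉ F) (z : Config E) (τ : E → ℕ)
    (K : Config E → Config E → Config E → R) (a : Bool) (hz : z f = a) :
    typedCount F z τ (fun x y w => K (Function.update x f a) (Function.update y f a)
      (Function.update w f a)) = typedCount F z τ K := by
  unfold typedCount
  refine Finset.sum_congr rfl fun x _ => Finset.sum_congr rfl fun y _ =>
    Finset.sum_congr rfl fun w _ => ?_
  split_ifs with h
  · obtain ⟨hx, hy, hw⟩ := h.1 f hf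
    show K (Function.update x f a) (Function.update y f a) (Function.update w f a) = K x y w
    rw [update_self_of_eq x f a (hx.trans hz), update_self_of_eq y f a (hy.trans hz),
      update_self_of_eq w f a (hw.trans hz)]
  · rfl

/-- A pinned edge `f ∉ F` may be put into `F` with the pinned type `0` / `3`. -/
lemma typedCount_insert_pinned (F : Finset E) (f : E) (hf : f ∉ F) (z : Config E) (τ : E → ℕ)
    (K : Config E → Config E → Config E → R) :
    typedCount (insert f F) z (Function.update τ f (if z f then 3 else 0)) K =
      typedCount F z τ K := by
  unfold typedCount
  refine Finset.sum_congr rfl fun x _ => Finset.sum_congr rfl fun y _ =>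
    Finset.sum_congr rfl fun w _ => ?_
  refine if_congr ?_ rfl rfl
  constructor
  · rintro ⟨h1, h2⟩
    have hfo := h2 f (Finset.mem_insert_self f F)
    rw [Function.update_self] at hfo
    refine ⟨fun e he => ?_, fun e he => ?_⟩
    · by_cases hef : e = f
      · subst hef
        cases hz : z e
        · simp only [hz, Bool.false_eq_true, if_false] at hfo
          simp only [openCount, Nat.add_eq_zero_iff, Bool.toNat_eq_zero] at hfo
          exact ⟨hfo.1.1, hfo.1.2, hfo.2⟩
        · simp only [hz, if_true] at hfo
          simp only [openCount] at hfo
          have hx : x e = true := by cases hx : x e <;> cases hy : y e <;> cases hw : w e <;> simp_all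
          have hy : y e = true := by cases hx : x e <;> cases hy : y e <;> cases hw : w e <;> simp_all
          have hw : w e = true := by cases hx : x e <;> cases hy : y e <;> cases hw : w e <;> simp_all
          exact ⟨hx, hy, hw⟩
      · exact h1 e (by rw [Finset.mem_insert, not_or]; exact ⟨hef, he⟩)
    · have hne : e ≠ f := fun h => hf (h ▸ he)
      have := h2 e (Finset.mem_insert_of_mem he)
      rwa [Function.update_of_ne hne] at this
  · rintro ⟨h1, h2⟩
    refine ⟨fun e he => h1 e (fun h => he (Finset.mem_insert_of_mem h)), fun e he => ?_⟩
    rw [Finset.mem_insert] at he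
    rcases he with rfl | he
    · rw [Function.update_self]
      have := h1 e hf
      simp only [openCount, this.1, this.2.1, this.2.2]
      cases z e <;> simp
    · have hne : e ≠ f := fun h => hf (h ▸ he)
      rw [Function.update_of_ne hne]
      exact h2 e he

/-- A typed edge of type `3` is the pinned-open edge of the smaller typed set. -/
lemma typedCount_type_three (F : Finset E) (f : E) (hf : f ∈ F) (z : Config E) (τ : E → ℕ)
    (hτ : τ f = 3) (K : Config E → Config E → Config E → R) :
    typedCount F z τ K = typedCount (F.erase f) (Function.update z f true) τ K := by
  have h := typedCount_insert_pinned (F.erase f) f (Finset.notMem_erase f F)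
    (Function.update z f true) τ K
  have h3 : (if true = true then 3 else 0) = 3 := rfl
  rw [Finset.insert_erase hf, Function.update_self, h3] at h
  refine Eq.trans ?_ h
  rw [typedCount_congr_z F (z' := Function.update z f true) (fun e he => ?_) τ K]
  · refine typedCount_congr_τ F _ (fun e _ => ?_) K
    by_cases hef : e = f
    · subst hef; rw [Function.update_self, hτ]
    · rw [Function.update_of_ne hef]
  · have hne : e ≠ f := fun h => he (h ▸ hf)
    rw [Function.update_of_ne hne]

/-- A typed edge of type `0` is the pinned-closed edge of the smaller typed set. -/
lemma typedCount_type_zero (F : Finset E) (f : E) (hf : f ∈ F) (z : Config E) (τ : E → ℕ)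
    (hτ : τ f = 0) (K : Config E → Config E → Config E → R) :
    typedCount F z τ K = typedCount (F.erase f) (Function.update z f false) τ K := by
  have h := typedCount_insert_pinned (F.erase f) f (Finset.notMem_erase f F)
    (Function.update z f false) τ K
  have h0 : (if false = true then 3 else 0) = 0 := rfl
  rw [Finset.insert_erase hf, Function.update_self, h0] at h
  refine Eq.trans ?_ h
  rw [typedCount_congr_z F (z' := Function.update z f false) (fun e he => ?_) τ K]
  · refine typedCount_congr_τ F _ (fun e _ => ?_) K
    by_cases hef : e = f
    · subst hef; rw [Function.update_self, hτ]
    · rw [Function.update_of_ne hef]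
  · have hne : e ≠ f := fun h => he (h ▸ hf)
    rw [Function.update_of_ne hne]

/-- The typed count with `e ∈ F` of type `3`, through the split: the copies are all opened at `e`. -/
lemma typedCount_split_three (F : Finset E) (e : E) (he : e ∈ F) (z : Config E) (τ : E → ℕ)
    (K : Config E → Config E → Config E → R) :
    typedCount F z (Function.update τ e 3) K =
      typedCount (F.erase e) (Function.update z e false) τ
        (fun x y w => K (Function.update x e true) (Function.update y e true)
          (Function.update w e true)) := by
  rw [typedCount_split F e he]
  simp only [Fintype.sum_bool, Bool.toNat_true, Bool.toNat_false, Function.update_self]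
  norm_num
  refine typedCount_congr_τ _ _ (fun e' he' => ?_) _
  rw [Function.update_of_ne (Finset.ne_of_mem_erase he')]

/-- The typed count with `e ∈ F` of type `0`, through the split: the copies are all closed at `e`. -/
lemma typedCount_split_zero (F : Finset E) (e : E) (he : e ∈ F) (z : Config E) (τ : E → ℕ)
    (K : Config E → Config E → Config E → R) :
    typedCount F z (Function.update τ e 0) K =
      typedCount (F.erase e) (Function.update z e false) τ
        (fun x y w => K (Function.update x e false) (Function.update y e false)
          (Function.update w e false)) := by
  rw [typedCount_split F e he]
  simp only [Fintype.sum_bool, Bool.toNat_true, Bool.toNat_false, Function.update_self]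
  norm_num
  refine typedCount_congr_τ _ _ (fun e' he' => ?_) _
  rw [Function.update_of_ne (Finset.ne_of_mem_erase he')]

end Book

end TypedRed

end CovForm

end Summit.Ventures.PercRepro2
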